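import Literature.NumberTheory.EllipticCurves.WeierstrassTransformation
import Literature.NumberTheory.EllipticCurves.WeierstrassTorsion
import Literature.NumberTheory.EllipticCurves.RealLatticeCovolumeProofs
import Mathlib.Analysis.Calculus.Deriv.Shift
import HarnessLib

/-!
# The Kummer function of a primitive half-period (line `nsf` v19, stub S3-K `stub_kummerFn`, crux `StarOptBNSF`, stmt-BirchSwinnertonDyer-27047)

**Stub S3-K CLOSED.**  For a period pair `L` (lattice `Λ`) and `λ ∈ Λ` with `λ/2 ∉ Λ` we construct `g : ℂ → ℂ`,
analytic off `Λ`, with `g(w)² = ℘(w) − ℘(λ/2)` off `Λ`, `g(w + ℓ) = g(w)` for `ℓ ∈ ℤλ + 2Λ` and `g(w + ℓ) = −g(w)`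
for the other `ℓ ∈ Λ` (the sign character of the `2`-torsion point `λ/2`).

Witness (Whittaker–Watson §20.33, Silverman AEC VI.3.6): `g(w) := S(w/2)` with
`S(v) := ((℘(v) − e)² − A)/℘′(v)`, `e := ℘(λ/2)`, `A := 3e² − g₂/4`.  Then
* `S(v)² = ℘(2v) − e` — the duplication formula `℘(2v) = ¼(℘″/℘′)² − 2℘` (tree
  `PeriodPair.weierstrassP_two_mul_holds`) with `℘″ = 6℘² − g₂/2` (tree `PeriodPair.deriv_derivWeierstrassP`),
  `℘′² = 4℘³ − g₂℘ − g₃` (Mathlib) and `4e³ − g₂e − g₃ = 0` (tree `PeriodPair.cubic_weierstrassP_halfPeriod_eq_zero`),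
  reduced to a polynomial identity (`kummerS_sq_alg`);
* for ANY half-period `h` (`h ∉ Λ ∋ 2h`), `e_h := ℘(h)`, `A_h := 3e_h² − g₂/4 ≠ 0`:
  `℘(v + h) = e_h + A_h/(℘(v) − e_h)` (tree `PeriodPair.weierstrassP_sub_halfPeriod`) and, differentiating this identity
  on a neighbourhood, `℘′(v + h) = −A_h℘′(v)/(℘(v) − e_h)²`; substituting, `S(v + h) = S(v)` if `e_h = e` and
  `S(v + h) = −S(v)` if `e_h ≠ e` (field identities `kummerS_translate_same/other`, with `A = (e − e_h)(2e + e_h)` from the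
  two cubic relations);
* `Λ`-periodicity of `S` and the dichotomy «`ℓ ∈ ℤλ + 2Λ` iff `ℓ/2 ∈ Λ` or `ℓ/2 ≡ λ/2`; otherwise `℘(ℓ/2) ≠ ℘(λ/2)`» finish.

The field identities of §1 are planner p2 GEN 36's `KummerFnAlgebra.lean` (CAS-certified, kit j314693), inlined.
Pure Weierstrass theory on `ℂ`; nothing here reads `r_an`; BSD is not proved by this file.
-/

set_option linter.dupNamespace false
set_option autoImplicit false

noncomputable section

open scoped Topology
open Filter Set Complex
open PeriodPair

namespace Summit.BirchSwinnertonDyer.BirchSwinnertonDyer.Theorems.DepletionAtTwo.KummerFn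

/-! ### §1 Field identities (p2 GEN 36 `KummerFnAlgebra`, any field of characteristic `0`) -/

section Algebra

variable {F : Type*} [Field F] [CharZero F]

/-- (K1b) `S(v)² = ℘(2v) − e₁`: with `P = ℘(v)`, `P′ = ℘′(v) ≠ 0`, `P′² = 4P³ − g₂P − g₃`, `e₁` a root of the cubic, and
`℘(2v) = ((6P² − g₂/2)/P′)²/4 − 2P` (duplication):
`(((P − e₁)² − (3e₁² − g₂/4))/P′)² = ((6P² − g₂/2)/P′)²/4 − 2P − e₁`. [cite: SilvermanAEC2009, VI.3.6] [folklore] -/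
theorem kummerS_sq_alg (P Pp e₁ g₂ g₃ : F) (hcubic : 4 * e₁ ^ 3 - g₂ * e₁ - g₃ = 0)
    (hPp : Pp ^ 2 = 4 * P ^ 3 - g₂ * P - g₃) (hPp0 : Pp ≠ 0) :
    (((P - e₁) ^ 2 - (3 * e₁ ^ 2 - g₂ / 4)) / Pp) ^ 2 = ((6 * P ^ 2 - g₂ / 2) / Pp) ^ 2 / 4 - 2 * P - e₁ := by
  have hg₃ : g₃ = 4 * e₁ ^ 3 - g₂ * e₁ := by linear_combination -hcubic
  have hPp2 : Pp ^ 2 ≠ 0 := pow_ne_zero 2 hPp0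
  rw [div_pow, div_pow, div_eq_iff hPp2, show (((6 * P ^ 2 - g₂ / 2) ^ 2 / Pp ^ 2 / 4 - 2 * P - e₁) * Pp ^ 2)
    = (6 * P ^ 2 - g₂ / 2) ^ 2 / 4 - (2 * P + e₁) * Pp ^ 2 by field_simp; ring, hPp, hg₃]
  ring

omit [CharZero F] in
/-- (K2+) invariance of `S` under translation by the half-period `λ/2` itself:
`P ↦ e₁ + A/(P − e₁)`, `P′ ↦ −A·P′/(P − e₁)²` (any `A ≠ 0`). [folklore] -/
theorem kummerS_translate_same (P Pp e₁ A : F) (hA : A ≠ 0) (hP : P - e₁ ≠ 0) (hPp0 : Pp ≠ 0) :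
    ((e₁ + A / (P - e₁) - e₁) ^ 2 - A) / (-A * Pp / (P - e₁) ^ 2) = ((P - e₁) ^ 2 - A) / Pp := by
  field_simp
  ring

omit [CharZero F] in
/-- Two distinct roots `e₁ ≠ e₂` of `4x³ − g₂x − g₃` determine `g₂ = 4(e₁² + e₁e₂ + e₂²)`. [folklore] -/
theorem g₂_eq_of_two_roots (e₁ e₂ g₂ g₃ : F) (h₁ : 4 * e₁ ^ 3 - g₂ * e₁ - g₃ = 0)
    (h₂ : 4 * e₂ ^ 3 - g₂ * e₂ - g₃ = 0) (he : e₁ ≠ e₂) : g₂ = 4 * (e₁ ^ 2 + e₁ * e₂ + e₂ ^ 2) := by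
  have h : (e₁ - e₂) * (4 * (e₁ ^ 2 + e₁ * e₂ + e₂ ^ 2) - g₂) = 0 := by linear_combination h₁ - h₂
  rcases mul_eq_zero.mp h with h0 | h0
  · exact absurd (sub_eq_zero.mp h0) he
  · linear_combination -h0

/-- … and then `A = 3e₁² − g₂/4 = (e₁ − e₂)(2e₁ + e₂)` (`= (e₁ − e₂)(e₁ − e₃)`, `e₃ = −e₁ − e₂`). [folklore] -/
theorem kummerA_eq_of_two_roots (e₁ e₂ g₂ g₃ : F) (h₁ : 4 * e₁ ^ 3 - g₂ * e₁ - g₃ = 0)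
    (h₂ : 4 * e₂ ^ 3 - g₂ * e₂ - g₃ = 0) (he : e₁ ≠ e₂) :
    3 * e₁ ^ 2 - g₂ / 4 = (e₁ - e₂) * (2 * e₁ + e₂) := by
  rw [g₂_eq_of_two_roots e₁ e₂ g₂ g₃ h₁ h₂ he]
  ring

omit [CharZero F] in
/-- (K2−) ANTI-invariance of `S` under translation by another half-period `μ/2`, `℘(μ/2) = e₂ ≠ e₁`:
with `A = (e₁ − e₂)(2e₁ + e₂)`, `A₂ = (e₂ − e₁)(2e₂ + e₁) ≠ 0`, `P ↦ e₂ + A₂/(P − e₂)`, `P′ ↦ −A₂·P′/(P − e₂)²`,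
`S ↦ −S`. [cite: SilvermanAEC2009, VI.3.6] [folklore] -/
theorem kummerS_translate_other (P Pp e₁ e₂ A A₂ : F) (hA : A = (e₁ - e₂) * (2 * e₁ + e₂))
    (hA₂ : A₂ = (e₂ - e₁) * (2 * e₂ + e₁)) (hA₂0 : A₂ ≠ 0) (hP : P - e₂ ≠ 0) (hPp0 : Pp ≠ 0) :
    ((e₂ + A₂ / (P - e₂) - e₁) ^ 2 - A) / (-A₂ * Pp / (P - e₂) ^ 2) = -(((P - e₁) ^ 2 - A) / Pp) := by
  subst hA
  rw [div_eq_iff (by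
    refine div_ne_zero (mul_ne_zero (neg_ne_zero.mpr hA₂0) hPp0) (pow_ne_zero 2 hP)), hA₂]
  field_simp
  ring

end Algebra

/-! ### §2 Lattice arithmetic around a half-period -/

variable (L : PeriodPair)

/-- `w ∉ Λ ⇒ w/2 ∉ Λ`. [folklore] -/
theorem half_notMem {w : ℂ} (hw : w ∉ L.lattice) : w / 2 ∉ L.lattice := fun h ↦
  hw (by rw [← add_halves w]; exact add_mem h h)

/-- `2v ∉ Λ`, `2h ∈ Λ` ⇒ `v + h ∉ Λ`. [folklore] -/
theorem add_notMem_of_two_mul {v h : ℂ} (h2v : 2 * v ∉ L.lattice) (h2h : 2 * h ∈ L.lattice) :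
    v + h ∉ L.lattice := fun hm ↦
  h2v (by rw [show 2 * v = (v + h) + (v + h) - 2 * h by ring]; exact sub_mem (add_mem hm hm) h2h)

/-- `2v ∉ Λ`, `2h ∈ Λ` ⇒ `v − h ∉ Λ`. [folklore] -/
theorem sub_notMem_of_two_mul {v h : ℂ} (h2v : 2 * v ∉ L.lattice) (h2h : 2 * h ∈ L.lattice) :
    v - h ∉ L.lattice := fun hm ↦
  h2v (by rw [show 2 * v = (v - h) + (v - h) + 2 * h by ring]; exact add_mem (add_mem hm hm) h2h)

/-- For `v, h ∉ Λ` with `v ± h ∉ Λ`: `℘(v) ≠ ℘(h)` (`℘(u) = ℘(v) ↔ u ≡ ±v`). [folklore] -/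
theorem weierstrassP_ne_of_notMem {v h : ℂ} (hv : v ∉ L.lattice) (hh : h ∉ L.lattice)
    (hvh : v + h ∉ L.lattice) (hvh' : v - h ∉ L.lattice) : ℘[L] v ≠ ℘[L] h := fun heq ↦ by
  rcases (L.weierstrassP_eq_weierstrassP_iff hv hh).mp heq with hm | hm
  exacts [hvh hm, hvh' hm]

/-! ### §3 Translation of `℘` and `℘′` by a half-period -/

/-- **Addition of a half-period** (Lawden (6.8.11), the tree's `PeriodPair.weierstrassP_sub_halfPeriod` at `w = −h`):
`℘(v + h) = e + (3e² − g₂/4)/(℘(v) − e)`, `e = ℘(h)`, for `h ∉ Λ ∋ 2h` and `v, v ± h ∉ Λ`.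
[cite: Lawden1989, §6.8 eq. (6.8.11)] -/
theorem weierstrassP_add_halfPeriod {h v : ℂ} (hh : h ∉ L.lattice) (h2h : 2 * h ∈ L.lattice)
    (hv : v ∉ L.lattice) (hvh : v + h ∉ L.lattice) (hvh' : v - h ∉ L.lattice) :
    ℘[L] (v + h) = ℘[L] h + (3 * ℘[L] h ^ 2 - L.g₂ / 4) / (℘[L] v - ℘[L] h) := by
  have hh' : -h ∉ L.lattice := fun hm ↦ hh (by simpa using neg_mem hm)
  have h2h' : 2 * -h ∈ L.lattice := by rw [mul_neg]; exact neg_mem h2h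
  have key := L.weierstrassP_sub_halfPeriod hh' h2h' hv (by rwa [sub_neg_eq_add]) (by rwa [← sub_eq_add_neg])
  rwa [sub_neg_eq_add, L.weierstrassP_neg] at key

/-- **`A_h = 3℘(h)² − g₂/4 ≠ 0` for a half-period `h`** (the cubic `4x³ − g₂x − g₃` is separable): otherwise
`℘(v + h) = ℘(h)` for every admissible `v`, e.g. `v = h/2`, forcing `h/2 ∈ Λ` or `h/2 + 2h ∈ Λ`. [folklore] -/
theorem kummerA_ne_zero {h : ℂ} (hh : h ∉ L.lattice) (h2h : 2 * h ∈ L.lattice) :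
    3 * ℘[L] h ^ 2 - L.g₂ / 4 ≠ 0 := by
  intro hA
  have h1 : h / 2 ∉ L.lattice := half_notMem L hh
  have h22 : 2 * (h / 2) ∉ L.lattice := by rwa [mul_div_cancel₀ h (two_ne_zero' ℂ)]
  have h2 : h / 2 + h ∉ L.lattice := add_notMem_of_two_mul L h22 h2h
  have h3 : h / 2 - h ∉ L.lattice := sub_notMem_of_two_mul L h22 h2h
  have key := weierstrassP_add_halfPeriod L hh h2h h1 h2 h3
  rw [hA, zero_div, add_zero] at key
  rcases (L.weierstrassP_eq_weierstrassP_iff h2 hh).mp key with hm | hm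
  · exact h1 (by rw [show h / 2 = (h / 2 + h + h) - 2 * h by ring]; exact sub_mem hm h2h)
  · exact h1 (by simpa using hm)

/-- **Derivative of the half-period addition formula**: `℘′(v + h) = −A_h·℘′(v)/(℘(v) − e)²` (`e = ℘(h)`,
`A_h = 3e² − g₂/4`), for `h ∉ Λ ∋ 2h` and `v, v ± h ∉ Λ` — differentiate `℘(z + h) = e + A_h/(℘(z) − e)`, valid on a
neighbourhood of `v`. [folklore] [cite: Lawden1989, §6.8] -/
theorem derivWeierstrassP_add_halfPeriod {h v : ℂ} (hh : h ∉ L.lattice) (h2h : 2 * h ∈ L.lattice)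
    (hv : v ∉ L.lattice) (hvh : v + h ∉ L.lattice) (hvh' : v - h ∉ L.lattice) :
    ℘'[L] (v + h) = -(3 * ℘[L] h ^ 2 - L.g₂ / 4) * ℘'[L] v / (℘[L] v - ℘[L] h) ^ 2 := by
  set e := ℘[L] h with he
  set A := 3 * e ^ 2 - L.g₂ / 4 with hA
  have ho : IsOpen ((L.lattice : Set ℂ)ᶜ) := L.isClosed_lattice.isOpen_compl
  have hPe : ℘[L] v - e ≠ 0 := sub_ne_zero.mpr (weierstrassP_ne_of_notMem L hv hh hvh hvh')
  -- the identity holds on a neighbourhood of `v`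
  have hU : ∀ᶠ z in 𝓝 v, z ∉ L.lattice ∧ z + h ∉ L.lattice ∧ z - h ∉ L.lattice := by
    refine (ho.eventually_mem hv).and (Filter.Eventually.and ?_ ?_)
    · exact ((continuous_id.add continuous_const).tendsto v).eventually (ho.eventually_mem hvh)
    · exact ((continuous_id.sub continuous_const).tendsto v).eventually (ho.eventually_mem hvh')
  have hEq : (fun z ↦ e + A * (℘[L] z - e)⁻¹) =ᶠ[𝓝 v] fun z ↦ ℘[L] (z + h) := by
    filter_upwards [hU] with z hz
    rw [weierstrassP_add_halfPeriod L hh h2h hz.1 hz.2.1 hz.2.2, div_eq_mul_inv]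
  have hd1 : HasDerivAt (fun z ↦ ℘[L] (z + h)) (℘'[L] (v + h)) v :=
    HasDerivAt.comp_add_const v h (L.hasDerivAt_weierstrassP hvh)
  have hd2 : HasDerivAt (fun z ↦ e + A * (℘[L] z - e)⁻¹) (A * (-(℘'[L] v) / (℘[L] v - e) ^ 2)) v :=
    ((((L.hasDerivAt_weierstrassP hv).sub_const e).inv hPe).const_mul A).const_add e
  have key := (hd1.congr_of_eventuallyEq hEq).unique hd2
  rw [key]
  ring

/-! ### §4 The function `S_e(v) = ((℘(v) − e)² − (3e² − g₂/4))/℘′(v)` -/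

/-- `S_e` is `Λ`-periodic. [folklore] -/
theorem kummerS_add_mem (e v : ℂ) {m : ℂ} (hm : m ∈ L.lattice) :
    ((℘[L] (v + m) - e) ^ 2 - (3 * e ^ 2 - L.g₂ / 4)) / ℘'[L] (v + m) =
      ((℘[L] v - e) ^ 2 - (3 * e ^ 2 - L.g₂ / 4)) / ℘'[L] v := by
  rw [← Subtype.coe_mk m hm, L.weierstrassP_add_coe, L.derivWeierstrassP_add_coe]

/-- **`S_e(v)² = ℘(2v) − e`** for `e` a root of `4x³ − g₂x − g₃` and `v ∉ Λ`, `2v ∉ Λ` (duplication formula).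
[cite: SilvermanAEC2009, VI.3.6] [folklore] -/
theorem kummerS_sq {e v : ℂ} (hcubic : 4 * e ^ 3 - L.g₂ * e - L.g₃ = 0) (hv : v ∉ L.lattice)
    (h2v : 2 * v ∉ L.lattice) :
    (((℘[L] v - e) ^ 2 - (3 * e ^ 2 - L.g₂ / 4)) / ℘'[L] v) ^ 2 = ℘[L] (2 * v) - e := by
  have hPp0 := L.derivWeierstrassP_ne_zero hv h2v
  have hdup := L.weierstrassP_two_mul_holds v hv hPp0
  rw [L.deriv_derivWeierstrassP hv] at hdup
  rw [hdup]
  exact kummerS_sq_alg (℘[L] v) (℘'[L] v) e L.g₂ L.g₃ hcubic (L.derivWeierstrassP_sq v hv) hPp0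

/-- `S_e` is analytic at every `v ∉ Λ` with `2v ∉ Λ`. [folklore] -/
theorem analyticAt_kummerS (e : ℂ) {v : ℂ} (hv : v ∉ L.lattice) (h2v : 2 * v ∉ L.lattice) :
    AnalyticAt ℂ (fun v ↦ ((℘[L] v - e) ^ 2 - (3 * e ^ 2 - L.g₂ / 4)) / ℘'[L] v) v := by
  have hP : AnalyticAt ℂ ℘[L] v := L.analyticOnNhd_weierstrassP v hv
  have hP' : AnalyticAt ℂ ℘'[L] v := L.analyticOnNhd_derivWeierstrassP v hv
  exact (((hP.sub analyticAt_const).pow 2).sub analyticAt_const).div hP' (L.derivWeierstrassP_ne_zero hv h2v)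

/-- **Same half-period: `S_e(v + h) = S_e(v)`** when `e = ℘(h)` (`h ∉ Λ ∋ 2h`, `v ∉ Λ`, `2v ∉ Λ`). [folklore] -/
theorem kummerS_add_halfPeriod_same {h v : ℂ} (hh : h ∉ L.lattice) (h2h : 2 * h ∈ L.lattice)
    (hv : v ∉ L.lattice) (h2v : 2 * v ∉ L.lattice) :
    ((℘[L] (v + h) - ℘[L] h) ^ 2 - (3 * ℘[L] h ^ 2 - L.g₂ / 4)) / ℘'[L] (v + h) =
      ((℘[L] v - ℘[L] h) ^ 2 - (3 * ℘[L] h ^ 2 - L.g₂ / 4)) / ℘'[L] v := by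
  have hvh := add_notMem_of_two_mul L h2v h2h
  have hvh' := sub_notMem_of_two_mul L h2v h2h
  have hPp0 := L.derivWeierstrassP_ne_zero hv h2v
  have hPe : ℘[L] v - ℘[L] h ≠ 0 := sub_ne_zero.mpr (weierstrassP_ne_of_notMem L hv hh hvh hvh')
  have hA := kummerA_ne_zero L hh h2h
  rw [weierstrassP_add_halfPeriod L hh h2h hv hvh hvh', derivWeierstrassP_add_halfPeriod L hh h2h hv hvh hvh']
  exact kummerS_translate_same (℘[L] v) (℘'[L] v) (℘[L] h) _ hA hPe hPp0

/-- **Other half-period: `S_e(v + h') = −S_e(v)`** when `e = ℘(h) ≠ ℘(h')` for half-periods `h, h'`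
(`v ∉ Λ`, `2v ∉ Λ`). [cite: SilvermanAEC2009, VI.3.6] [folklore] -/
theorem kummerS_add_halfPeriod_other {h h' v : ℂ} (hh : h ∉ L.lattice) (h2h : 2 * h ∈ L.lattice)
    (hh' : h' ∉ L.lattice) (h2h' : 2 * h' ∈ L.lattice) (hne : ℘[L] h' ≠ ℘[L] h)
    (hv : v ∉ L.lattice) (h2v : 2 * v ∉ L.lattice) :
    ((℘[L] (v + h') - ℘[L] h) ^ 2 - (3 * ℘[L] h ^ 2 - L.g₂ / 4)) / ℘'[L] (v + h') =
      -(((℘[L] v - ℘[L] h) ^ 2 - (3 * ℘[L] h ^ 2 - L.g₂ / 4)) / ℘'[L] v) := by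
  have hvh := add_notMem_of_two_mul L h2v h2h'
  have hvh' := sub_notMem_of_two_mul L h2v h2h'
  have hPp0 := L.derivWeierstrassP_ne_zero hv h2v
  have hPe : ℘[L] v - ℘[L] h' ≠ 0 := sub_ne_zero.mpr (weierstrassP_ne_of_notMem L hv hh' hvh hvh')
  have hc := L.cubic_weierstrassP_halfPeriod_eq_zero hh h2h
  have hc' := L.cubic_weierstrassP_halfPeriod_eq_zero hh' h2h'
  have hA := kummerA_eq_of_two_roots (℘[L] h) (℘[L] h') L.g₂ L.g₃ hc hc' hne.symm
  have hA' := kummerA_eq_of_two_roots (℘[L] h') (℘[L] h) L.g₂ L.g₃ hc' hc hne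
  have hA'0 := kummerA_ne_zero L hh' h2h'
  rw [weierstrassP_add_halfPeriod L hh' h2h' hv hvh hvh', derivWeierstrassP_add_halfPeriod L hh' h2h' hv hvh hvh']
  exact kummerS_translate_other (℘[L] v) (℘'[L] v) (℘[L] h) (℘[L] h') _ _ hA hA' hA'0 hPe hPp0

/-! ### §5 The stub -/

/-- **Stub S3-K `stub_kummerFn` of line `nsf` v19 (crux `StarOptBNSF`, stmt-BirchSwinnertonDyer-27047), registered
signature verbatim.**  THE KUMMER FUNCTION of a primitive half-period: for a period pair `L` and `λ ∈ Λ` with `λ/2 ∉ Λ`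
there is `g : ℂ → ℂ`, analytic off `Λ`, with `g(w)² = ℘_L(w) − ℘_L(λ/2)` off `Λ` and, off `Λ`, `g(w + ℓ) = g(w)` for
`ℓ ∈ ℤλ + 2Λ` and `g(w + ℓ) = −g(w)` for the other `ℓ ∈ Λ`.  Witness `g(w) = S_e(w/2)`, `e = ℘(λ/2)` (§4).
[cite: SilvermanAEC2009, VI.3.6] [cite: WhittakerWatson1927, §20.33] [folklore] -/
theorem stub_kummerFn :
    ∀ (L : PeriodPair) (lam : ℂ), lam ∈ L.lattice → lam / 2 ∉ L.lattice →
      ∃ g : ℂ → ℂ,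
        (∀ w : ℂ, w ∉ L.lattice → AnalyticAt ℂ g w ∧ g w ^ 2 = L.weierstrassP w - L.weierstrassP (lam / 2)) ∧
        (∀ w ℓ : ℂ, w ∉ L.lattice → ℓ ∈ L.lattice →
          (∃ k : ℤ, ∃ m ∈ L.lattice, ℓ = (k : ℂ) * lam + 2 * m) → g (w + ℓ) = g w) ∧
        (∀ w ℓ : ℂ, w ∉ L.lattice → ℓ ∈ L.lattice →
          (¬ ∃ k : ℤ, ∃ m ∈ L.lattice, ℓ = (k : ℂ) * lam + 2 * m) → g (w + ℓ) = -g w) := by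
  intro L lam hlam hlam2
  have h2lam : 2 * (lam / 2) ∈ L.lattice := by rwa [mul_div_cancel₀ lam (two_ne_zero' ℂ)]
  have hcubic := L.cubic_weierstrassP_halfPeriod_eq_zero hlam2 h2lam
  -- side condition at `v = w/2`
  have hw2 : ∀ {w : ℂ}, w ∉ L.lattice → 2 * (w / 2) ∉ L.lattice := fun hw ↦ by
    rwa [mul_div_cancel₀ _ (two_ne_zero' ℂ)]
  refine ⟨fun w ↦ ((℘[L] (w / 2) - ℘[L] (lam / 2)) ^ 2 - (3 * ℘[L] (lam / 2) ^ 2 - L.g₂ / 4)) / ℘'[L] (w / 2),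
    fun w hw ↦ ⟨?_, ?_⟩, fun w ℓ hw hℓ hk ↦ ?_, fun w ℓ hw hℓ hk ↦ ?_⟩
  · -- analytic at `w`
    have hS := analyticAt_kummerS L (℘[L] (lam / 2)) (half_notMem L hw) (hw2 hw)
    have hdiv : AnalyticAt ℂ (fun w : ℂ ↦ w / 2) w := analyticAt_id.div_const
    have hc : AnalyticAt ℂ
        ((fun v ↦ ((℘[L] v - ℘[L] (lam / 2)) ^ 2 - (3 * ℘[L] (lam / 2) ^ 2 - L.g₂ / 4)) / ℘'[L] v) ∘
          (fun w : ℂ ↦ w / 2)) w :=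
      AnalyticAt.comp_of_eq
        (g := fun v ↦ ((℘[L] v - ℘[L] (lam / 2)) ^ 2 - (3 * ℘[L] (lam / 2) ^ 2 - L.g₂ / 4)) / ℘'[L] v)
        (f := fun w : ℂ ↦ w / 2) hS hdiv rfl
    exact hc
  · -- `g(w)² = ℘(w) − e`
    dsimp only
    rw [kummerS_sq L hcubic (half_notMem L hw) (hw2 hw), mul_div_cancel₀ w (two_ne_zero' ℂ)]
  · -- `ℓ = kλ + 2m`: `ℓ/2 ∈ Λ` (k even) or `ℓ/2 ≡ λ/2 (mod Λ)` (k odd)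
    obtain ⟨k, m, hm, rfl⟩ := hk
    dsimp only
    obtain ⟨j, rfl | rfl⟩ := Int.even_or_odd' k
    · have hmem : (j : ℂ) * lam + m ∈ L.lattice := add_mem (PeriodPair.intCast_mul_mem hlam j) hm
      rw [show (w + (((2 * j : ℤ) : ℂ) * lam + 2 * m)) / 2 = w / 2 + ((j : ℂ) * lam + m) by push_cast; ring]
      exact kummerS_add_mem L _ _ hmem
    · have hmem : (j : ℂ) * lam + m ∈ L.lattice := add_mem (PeriodPair.intCast_mul_mem hlam j) hm
      rw [show (w + (((2 * j + 1 : ℤ) : ℂ) * lam + 2 * m)) / 2 = w / 2 + lam / 2 + ((j : ℂ) * lam + m) by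
        push_cast; ring, kummerS_add_mem L _ _ hmem]
      exact kummerS_add_halfPeriod_same L hlam2 h2lam (half_notMem L hw) (hw2 hw)
  · -- `ℓ ∉ ℤλ + 2Λ`: `ℓ/2` is a half-period with `℘(ℓ/2) ≠ ℘(λ/2)`
    dsimp only
    have hℓ2 : ℓ / 2 ∉ L.lattice := fun hm ↦ hk ⟨0, ℓ / 2, hm, by push_cast; ring⟩
    have h2ℓ : 2 * (ℓ / 2) ∈ L.lattice := by rwa [mul_div_cancel₀ ℓ (two_ne_zero' ℂ)]
    have hne : ℘[L] (ℓ / 2) ≠ ℘[L] (lam / 2) := by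
      intro heq
      rcases (L.weierstrassP_eq_weierstrassP_iff hℓ2 hlam2).mp heq with hm | hm
      · exact hk ⟨-1, ℓ / 2 + lam / 2, hm, by push_cast; ring⟩
      · exact hk ⟨1, ℓ / 2 - lam / 2, hm, by push_cast; ring⟩
    rw [add_div]
    exact kummerS_add_halfPeriod_other L hlam2 h2lam hℓ2 h2ℓ hne (half_notMem L hw) (hw2 hw)

end Summit.BirchSwinnertonDyer.BirchSwinnertonDyer.Theorems.DepletionAtTwo.KummerFn

end
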